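import Mathlib
import Summits.Ventures.PercRepro2.ReimerIncreasing

/-!
# Reimer's inequality restricted to a decreasing event (blind cell PercRepro2, mine-1)

`reimer_decreasing` (`MINE-1.md` Theorem 16.1): for increasing events `A`, `B` on the cube `U` and a
DECREASING event `D`, Reimer's counting inequality `#{A □ B} ≤ #{S ∈ A, U \ S ∈ B}` stays valid when
both sides are restricted to `D`:

  `#{S ⊆ U : A □ B at S, S ∈ D} ≤ #{S ⊆ U : S ∈ A, U \ S ∈ B, S ∈ D}`.

Since `(A □ B) ∩ D = (A ∩ D) □ B` for increasing `A`, `B` and decreasing `D`, this is Reimer's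
"butterfly" inequality for the CONVEX first event `A ∩ D` (a special case of Reimer's theorem for
arbitrary events), proved here without the butterfly lemma: the Bollobás–Leader induction of
`reimer_increasing` goes through because the restriction is monotone — the level-1 sections are
`(A₀ □ B₁ ∪ A₁ □ B₀) ∩ D₁` with `D₁ ⊆ D₀`, and the part of `A₀ □ B₀` living on `D₀ \ D₁` is
absorbed by the induction hypothesis for `(A₀, B₁)` on the LARGER set `D₀`.

The increasing mirror (restriction to an increasing event) is false already for `D = {some
coordinate red}`.
-/

namespace Summit.Ventures.PercRepro2

namespace ReimerCube

variable {E : Type*}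

/-- A decreasing event: closed under shrinking the red set. -/
def Decr (D : Finset E → Prop) : Prop := ∀ ⦃S T : Finset E⦄, S ⊆ T → D T → D S

variable [DecidableEq E]

/-- The section at `i` open of a decreasing event is decreasing. -/
lemma decr_sec1 {D : Finset E → Prop} (hD : Decr D) (i : E) : Decr (sec1 i D) :=
  fun _ _ hST h => hD (Finset.insert_subset_insert i hST) h

/-- For decreasing `D`, `D (insert i S)` implies `D S`: the section at `i` open is contained in the
section at `i` closed. -/
lemma sec1_le_decr {D : Finset E → Prop} (hD : Decr D) (i : E) (S : Finset E) (h : sec1 i D S) :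
    D S := hD (Finset.subset_insert i S) h

open Classical in
/-- **Reimer's inequality restricted to a decreasing event (MINE-1 Theorem 16.1).**  For increasing
`A`, `B`, a decreasing `D` and a ground set `U`:
`#{S ⊆ U : A □ B at S ∧ S ∈ D} ≤ #{S ⊆ U : S ∈ A ∧ U \ S ∈ B ∧ S ∈ D}`. -/
theorem reimer_decreasing (U : Finset E) :
    ∀ (A B D : Finset E → Prop), Incr A → Incr B → Decr D →
      (U.powerset.filter (fun S => DOcc A B S ∧ D S)).card
        ≤ (U.powerset.filter (fun S => A S ∧ B (U \ S) ∧ D S)).card := by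
  induction U using Finset.induction_on with
  | empty =>
    intro A B D _ _ _
    apply Finset.card_le_card
    intro S hS
    rw [Finset.mem_filter, Finset.mem_powerset] at hS ⊢
    obtain ⟨hS0, ⟨K, L, hK, hL, -, hAK, hBL⟩, hDS⟩ := hS
    have hS0' : S = ∅ := Finset.subset_empty.mp hS0
    rw [hS0'] at hL
    exact ⟨hS0, hAK S hK, hBL _ (hL.trans (Finset.empty_subset _)), hDS⟩
  | insert i U hi ih =>
    intro A B D hA hB hD
    have hD10 : ∀ S, sec1 i D S → D S := fun S h => sec1_le_decr hD i S h
    rw [card_filter_powerset_insert hi, card_filter_powerset_insert hi]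
    -- rewrite the level-1 filters on `𝒫(U)` through the sections
    have e1 : U.powerset.filter (fun S => DOcc A B (insert i S) ∧ D (insert i S))
        = U.powerset.filter
            (fun S => (DOcc A (sec1 i B) S ∨ DOcc (sec1 i A) B S) ∧ sec1 i D S) := by
      apply Finset.filter_congr
      intro S hS
      rw [dOcc_insert_iff hB (fun h => hi (Finset.mem_powerset.mp hS h))]
      rfl
    have e2 : U.powerset.filter (fun S => A S ∧ B (insert i U \ S) ∧ D S)
        = U.powerset.filter (fun S => A S ∧ sec1 i B (U \ S) ∧ D S) := by
      apply Finset.filter_congr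
      intro S hS
      rw [insert_sdiff_of_not_mem' (Finset.mem_powerset.mp hS) hi]
      rfl
    have e3 : U.powerset.filter
          (fun S => A (insert i S) ∧ B (insert i U \ insert i S) ∧ D (insert i S))
        = U.powerset.filter (fun S => sec1 i A S ∧ B (U \ S) ∧ sec1 i D S) := by
      apply Finset.filter_congr
      intro S _
      rw [insert_sdiff_insert' hi]
      rfl
    rw [e1, e2, e3]
    -- inclusion–exclusion at level 1 (inside `D₁`)
    have hU : U.powerset.filter
          (fun S => (DOcc A (sec1 i B) S ∨ DOcc (sec1 i A) B S) ∧ sec1 i D S)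
        = U.powerset.filter (fun S => DOcc A (sec1 i B) S ∧ sec1 i D S)
          ∪ U.powerset.filter (fun S => DOcc (sec1 i A) B S ∧ sec1 i D S) := by
      ext S
      simp only [Finset.mem_filter, Finset.mem_union]
      tauto
    have hI : U.powerset.filter
          (fun S => (DOcc A (sec1 i B) S ∧ DOcc (sec1 i A) B S) ∧ sec1 i D S)
        = U.powerset.filter (fun S => DOcc A (sec1 i B) S ∧ sec1 i D S)
          ∩ U.powerset.filter (fun S => DOcc (sec1 i A) B S ∧ sec1 i D S) := by
      ext S
      simp only [Finset.mem_filter, Finset.mem_inter]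
      tauto
    have h_or := Finset.card_union_add_card_inter
      (U.powerset.filter (fun S => DOcc A (sec1 i B) S ∧ sec1 i D S))
      (U.powerset.filter (fun S => DOcc (sec1 i A) B S ∧ sec1 i D S))
    rw [← hU, ← hI] at h_or
    -- `A₀ □ B₀ ⊆ A₀ □ B₁ ∩ A₁ □ B₀`, inside `D₁`
    have h_sub : (U.powerset.filter (fun S => DOcc A B S ∧ sec1 i D S)).card
        ≤ (U.powerset.filter
            (fun S => (DOcc A (sec1 i B) S ∧ DOcc (sec1 i A) B S) ∧ sec1 i D S)).card := by
      apply Finset.card_le_card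
      intro S hS
      rw [Finset.mem_filter] at hS ⊢
      exact ⟨hS.1, ⟨hS.2.1.mono_right (incr_le_sec1 hB i), hS.2.1.mono_left (incr_le_sec1 hA i)⟩,
        hS.2.2⟩
    -- split the level-0 counts along `D₁ ⊆ D₀`
    have hs1 : (U.powerset.filter (fun S => DOcc A B S ∧ D S)).card
        = (U.powerset.filter (fun S => DOcc A B S ∧ sec1 i D S)).card
          + (U.powerset.filter (fun S => DOcc A B S ∧ D S ∧ ¬ sec1 i D S)).card := by
      have h := Finset.card_filter_add_card_filter_not
        (s := U.powerset.filter (fun S => DOcc A B S ∧ D S)) (fun S => sec1 i D S)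
      rw [Finset.filter_filter, Finset.filter_filter] at h
      have f1 : U.powerset.filter (fun S => (DOcc A B S ∧ D S) ∧ sec1 i D S)
          = U.powerset.filter (fun S => DOcc A B S ∧ sec1 i D S) := by
        apply Finset.filter_congr
        intro S _
        constructor
        · rintro ⟨⟨h1, -⟩, h3⟩
          exact ⟨h1, h3⟩
        · rintro ⟨h1, h3⟩
          exact ⟨⟨h1, hD10 S h3⟩, h3⟩
      have f2 : U.powerset.filter (fun S => (DOcc A B S ∧ D S) ∧ ¬ sec1 i D S)
          = U.powerset.filter (fun S => DOcc A B S ∧ D S ∧ ¬ sec1 i D S) := by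
        apply Finset.filter_congr
        intro S _
        tauto
      rw [f1, f2] at h
      omega
    have hs2 : (U.powerset.filter (fun S => DOcc A (sec1 i B) S ∧ D S)).card
        = (U.powerset.filter (fun S => DOcc A (sec1 i B) S ∧ sec1 i D S)).card
          + (U.powerset.filter (fun S => DOcc A (sec1 i B) S ∧ D S ∧ ¬ sec1 i D S)).card := by
      have h := Finset.card_filter_add_card_filter_not
        (s := U.powerset.filter (fun S => DOcc A (sec1 i B) S ∧ D S)) (fun S => sec1 i D S)
      rw [Finset.filter_filter, Finset.filter_filter] at h
      have f1 : U.powerset.filter (fun S => (DOcc A (sec1 i B) S ∧ D S) ∧ sec1 i D S)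
          = U.powerset.filter (fun S => DOcc A (sec1 i B) S ∧ sec1 i D S) := by
        apply Finset.filter_congr
        intro S _
        constructor
        · rintro ⟨⟨h1, -⟩, h3⟩
          exact ⟨h1, h3⟩
        · rintro ⟨h1, h3⟩
          exact ⟨⟨h1, hD10 S h3⟩, h3⟩
      have f2 : U.powerset.filter (fun S => (DOcc A (sec1 i B) S ∧ D S) ∧ ¬ sec1 i D S)
          = U.powerset.filter (fun S => DOcc A (sec1 i B) S ∧ D S ∧ ¬ sec1 i D S) := by
        apply Finset.filter_congr
        intro S _
        tauto
      rw [f1, f2] at h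
      omega
    -- on `D₀ \ D₁`: `A₀ □ B₀ ⊆ A₀ □ B₁`
    have h_sub2 : (U.powerset.filter (fun S => DOcc A B S ∧ D S ∧ ¬ sec1 i D S)).card
        ≤ (U.powerset.filter (fun S => DOcc A (sec1 i B) S ∧ D S ∧ ¬ sec1 i D S)).card := by
      apply Finset.card_le_card
      intro S hS
      rw [Finset.mem_filter] at hS ⊢
      exact ⟨hS.1, hS.2.1.mono_right (incr_le_sec1 hB i), hS.2.2⟩
    have ih1 := ih A (sec1 i B) D hA (incr_sec1 hB i) hD
    have ih2 := ih (sec1 i A) B (sec1 i D) (incr_sec1 hA i) hB (decr_sec1 hD i)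
    omega

/-! ## The form used for the R13 crux: restriction to `{blue ∈ C}` for an increasing `C` -/

/-- For increasing `C`, the event "the blue part `U \ S` lies in `C`" is decreasing in `S`. -/
lemma decr_bar {C : Finset E → Prop} (hC : Incr C) (U : Finset E) :
    Decr (fun S => C (U \ S)) :=
  fun _ _ hST h => hC (Finset.sdiff_subset_sdiff (Finset.Subset.refl U) hST) h

open Classical in
/-- Reimer's inequality restricted to the configurations whose blue part lies in an increasing
event `C` (`MINE-1.md` §16.2: both pieces of Conjecture AC are of this form). -/
theorem reimer_restrict_bar (U : Finset E) (A B C : Finset E → Prop) (hA : Incr A) (hB : Incr B)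
    (hC : Incr C) :
    (U.powerset.filter (fun S => DOcc A B S ∧ C (U \ S))).card
      ≤ (U.powerset.filter (fun S => A S ∧ B (U \ S) ∧ C (U \ S))).card :=
  reimer_decreasing U A B (fun S => C (U \ S)) hA hB (decr_bar hC U)

end ReimerCube

end Summit.Ventures.PercRepro2
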